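import Literature.Probability.Percolation.AnchoredIsoperimetricProfileProofs
import Literature.Probability.Percolation.PercolationEvents
import HarnessLib

/-!
# The anchored isoperimetric profile: confinement to a box, locality, measurability (proofs)

Third PROOFS companion of `AnchoredIsoperimetricProfile.lean`; everything here is proved, no named
facts. For a LATTICE configuration `ω ⊆ E(ℤ^d)` (true `P_p`-a.s.) the anchored profile `φ̂_n`
([CerfDembin2020, §1]) is a *local* function of `ω`:

* §6 a valid subgraph `H` ([CerfDembin2020, §1]: "`H` connected and `0 ∈ H ⊂ C(0)`") lies in the
  box `B(|H| - 1)` (an open path inside `H` from `0` is a lattice path with fewer than `|H|`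
  steps), so the competitors of `φ̂_n` (`|H| ≤ n^d`) and their boundary edges live in `B(n^d)`;
* §7 hence `φ̂_n(ω)` depends only on the states of the lattice edges inside `B(R)`, `R ≥ n^d`
  (`anchoredProfile_congr`), and
* §8 `ω ↦ φ̂_n(ω ∩ E(ℤ^d))` is measurable for the product σ-algebra (a function determined by
  finitely many coordinates; `DeterminedBy.measurableSet_of_finset` of `PercolationEvents.lean`),
  so `φ̂_n` is `P_p`-a.e.-measurable (`aemeasurable_anchoredProfile`) — the (implicit) standing
  fact behind every probability written in [CerfDembin2020] and [Dembin2020], e.g. the large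
  deviation events `{n φ_n ≥ (1 + ε) φ}` of [Dembin2020, §1].

Sources: [CerfDembin2020] R. Cerf, B. Dembin, ECP 25 (2020), §1; [Dembin2020] B. Dembin,
ALEA 17 (2020), §1; Grimmett, *Percolation* (1999), §2.2 (events depending on finitely many
edges). Imports: the first proofs companion and `PercolationEvents` (finite dependence).
-/

noncomputable section

namespace Literature.Probability.Percolation

open Finset LatticeModels
open _root_.MeasureTheory _root_.Filter
open scoped _root_.Topology

variable {d : ℕ}

/-! ## §6 Valid subgraphs live in a box -/

section Box

/-- Along a walk of a graph mapping homomorphically to `ℤ^d` (e.g. a subgraph of `ℤ^d`, or an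
induced subgraph of one), every coordinate of the image changes by at most the length of the walk:
a lattice step `x ∼ x ± eⱼ` changes every coordinate by at most one. [folklore] -/
theorem abs_sub_apply_le_length_of_hom {W : Type*} {G' : SimpleGraph W} (φ : G' →g zdGraph d)
    {x y : W} (p : G'.Walk x y) (i : Fin d) : |φ y i - φ x i| ≤ p.length := by
  induction p with
  | nil => simp
  | cons h p ih =>
    rw [SimpleGraph.Walk.length_cons, Nat.cast_add, Nat.cast_one]
    refine (abs_sub_le _ _ _).trans (add_le_add ih ?_)
    -- one lattice step
    obtain ⟨j, hj | hj⟩ := (zdGraph_adj_iff _ _).1 (φ.map_adj h)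
    · rw [hj]
      by_cases hij : i = j
      · subst hij; simp
      · simp [Pi.single_eq_of_ne hij]
    · rw [hj]
      by_cases hij : i = j
      · subst hij; simp
      · simp [Pi.single_eq_of_ne hij]

/-- **A valid subgraph lies in the box `B(|H| - 1)`** (`ω ⊆ E(ℤ^d)`): every `x ∈ H` is joined
to `0` by an open path inside `H`, which may be taken self-avoiding, hence of fewer than `|H|`
lattice steps. [cite: CerfDembin2020, §1 (valid subgraph of C(0))] -/
theorem IsValidSubgraph.mem_box {ω : BondConfig (Site d)} (hω : ω ⊆ (zdGraph d).edgeSet)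
    {H : Finset (Site d)} (hH : IsValidSubgraph d ω H) {x : Site d} (hx : x ∈ H) :
    x ∈ box d (H.card - 1) := by
  classical
  obtain ⟨h0, hx', ⟨q⟩⟩ := hH.2 x hx
  have hcard : Fintype.card (↑(↑H : Set (Site d))) = H.card :=
    Fintype.card_of_subtype H fun _ => Finset.mem_coe.symm
  have hlen : (q.toPath : ((openGraph ω).induce (↑H : Set (Site d))).Walk ⟨0, h0⟩ ⟨x, hx'⟩).length
      < H.card := hcard ▸ q.toPath.2.length_lt
  -- the induced open graph on `H` maps homomorphically into `ℤ^d` (`ω ⊆ E(ℤ^d)`)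
  have hle : openGraph ω ≤ zdGraph d := fun a b hab => hω ((openGraph_adj ω a b).1 hab).1
  let φ : (openGraph ω).induce (↑H : Set (Site d)) →g zdGraph d :=
    (SimpleGraph.Hom.ofLE hle).comp (SimpleGraph.Embedding.induce (↑H : Set (Site d))).toHom
  rw [LatticeModels.mem_box]
  intro i
  have h : |x i - (0 : Site d) i| ≤
      ((q.toPath : ((openGraph ω).induce (↑H : Set (Site d))).Walk ⟨0, h0⟩ ⟨x, hx'⟩).length :
        ℤ) :=
    abs_sub_apply_le_length_of_hom φ _ i
  rw [Pi.zero_apply, sub_zero] at h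
  have h' : |x i| ≤ ((H.card - 1 : ℕ) : ℤ) := h.trans (by omega)
  exact abs_le.1 h'

/-- Consequently a neighbour (in `ℤ^d`) of a vertex of a valid `H` lies in `B(|H|)`.
[cite: CerfDembin2020, §1 (valid subgraph of C(0))] -/
theorem IsValidSubgraph.mem_box_of_adj {ω : BondConfig (Site d)} (hω : ω ⊆ (zdGraph d).edgeSet)
    {H : Finset (Site d)} (hH : IsValidSubgraph d ω H) {a b : Site d} (ha : a ∈ H)
    (hab : (zdGraph d).Adj a b) : b ∈ box d H.card := by
  have ha' := hH.mem_box hω ha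
  rw [LatticeModels.mem_box] at ha' ⊢
  intro i
  have h1 : |b i - a i| ≤ 1 := by
    have h := abs_sub_apply_le_length_of_hom (SimpleGraph.Hom.id : zdGraph d →g zdGraph d)
      hab.toWalk i
    rwa [SimpleGraph.Walk.length_cons, SimpleGraph.Walk.length_nil] at h
  have h1 := abs_le.1 h1
  have h2 := ha' i
  have hpos := hH.card_pos
  constructor <;> omega

end Box

/-! ## §7 Locality: `φ̂_n` depends only on the edges inside `B(R)`, `R ≥ n^d` -/

section Locality

/-- One inclusion of locality: if two lattice configurations agree on the lattice edges inside
`B(R)` and `n^d ≤ R`, every competing ratio for `ω` is a competing ratio for `ω'` (the competitor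
`H ⊆ B(R - 1)` is valid for `ω'` as well, with the same open boundary edges).
[cite: CerfDembin2020, §1 (definition of φ̂_n)] -/
theorem anchoredProfile_ratioSet_subset_of_inter_eq {n R : ℕ} (hR : n ^ d ≤ R)
    {ω ω' : BondConfig (Site d)} (hω : ω ⊆ (zdGraph d).edgeSet) (hω' : ω' ⊆ (zdGraph d).edgeSet)
    (h : ω ∩ ↑(edgesIn (zdGraph d) (box d R)) = ω' ∩ ↑(edgesIn (zdGraph d) (box d R))) :
    {r : ℝ | ∃ H : Finset (Site d), IsValidSubgraph d ω H ∧ 0 < H.card ∧ H.card ≤ n ^ d ∧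
      r = (openEdgeBoundaryCard d ω H : ℝ) / H.card} ⊆
    {r : ℝ | ∃ H : Finset (Site d), IsValidSubgraph d ω' H ∧ 0 < H.card ∧ H.card ≤ n ^ d ∧
      r = (openEdgeBoundaryCard d ω' H : ℝ) / H.card} := by
  classical
  rintro r ⟨H, hH, h0, hn, rfl⟩
  -- every lattice edge with an endpoint in `H` lies inside `B(R)`
  have hK : ∀ ⦃a b : Site d⦄, a ∈ H → (zdGraph d).Adj a b →
      s(a, b) ∈ (↑(edgesIn (zdGraph d) (box d R)) : Set (Sym2 (Site d))) := by
    intro a b ha hab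
    rw [Finset.mem_coe, mem_edgesIn_iff]
    refine ⟨hab, ?_⟩
    have hb : b ∈ box d R := box_mono d (hn.trans hR) (hH.mem_box_of_adj hω ha hab)
    have ha' : a ∈ box d R :=
      box_mono d (le_trans (Nat.sub_le _ _) (hn.trans hR)) (hH.mem_box hω ha)
    intro z hz
    rcases Sym2.mem_iff.1 hz with rfl | rfl
    · exact ha'
    · exact hb
  -- hence the two configurations agree on all pairs with an endpoint in `H`
  have hagree : ∀ ⦃a b : Site d⦄, a ∈ H → (s(a, b) ∈ ω ↔ s(a, b) ∈ ω') := by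
    intro a b ha
    constructor
    · intro he
      have hmem : s(a, b) ∈ ω ∩ ↑(edgesIn (zdGraph d) (box d R)) := ⟨he, hK ha (hω he)⟩
      rw [h] at hmem
      exact hmem.1
    · intro he
      have hmem : s(a, b) ∈ ω' ∩ ↑(edgesIn (zdGraph d) (box d R)) := ⟨he, hK ha (hω' he)⟩
      rw [← h] at hmem
      exact hmem.1
  -- validity transfers
  have hG : (openGraph ω).induce (↑H : Set (Site d)) = (openGraph ω').induce (↑H : Set (Site d)) := by
    ext a b
    simp only [SimpleGraph.comap_adj, Function.Embedding.coe_subtype, openGraph_adj]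
    rw [hagree a.2]
  have hH' : IsValidSubgraph d ω' H := by
    refine ⟨hH.1, fun x hx => ?_⟩
    obtain ⟨h0', hx', hr⟩ := hH.2 x hx
    exact ⟨h0', hx', hG ▸ hr⟩
  -- the open boundary edges are the same
  have hbdry : ∀ e ∈ edgeBoundary (zdGraph d) H, (e ∈ ω ↔ e ∈ ω') := by
    intro e he
    rw [mem_edgeBoundary_iff] at he
    obtain ⟨-, ⟨a, ha, hae⟩, ⟨b, hb, hbe⟩⟩ := he
    have hne : a ≠ b := fun hab => hb (hab ▸ ha)
    have heq : e = s(a, b) := (Sym2.mem_and_mem_iff hne).1 ⟨hae, hbe⟩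
    subst heq
    exact hagree ha
  have hB : ((↑(edgeBoundary (zdGraph d) H) : Set (Sym2 (Site d))) ∩ ω) =
      ((↑(edgeBoundary (zdGraph d) H) : Set (Sym2 (Site d))) ∩ ω') := by
    ext e
    exact ⟨fun ⟨he, heω⟩ => ⟨he, (hbdry e he).1 heω⟩, fun ⟨he, heω⟩ => ⟨he, (hbdry e he).2 heω⟩⟩
  refine ⟨H, hH', h0, hn, ?_⟩
  rw [openEdgeBoundaryCard, openEdgeBoundaryCard, hB]

/-- **Locality of the anchored profile**: two lattice configurations agreeing on the lattice edges
inside the box `B(R)`, `R ≥ n^d`, have the same `φ̂_n`.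
[cite: CerfDembin2020, §1 (definition of φ̂_n)] -/
theorem anchoredProfile_congr {n R : ℕ} (hR : n ^ d ≤ R) {ω ω' : BondConfig (Site d)}
    (hω : ω ⊆ (zdGraph d).edgeSet) (hω' : ω' ⊆ (zdGraph d).edgeSet)
    (h : ω ∩ ↑(edgesIn (zdGraph d) (box d R)) = ω' ∩ ↑(edgesIn (zdGraph d) (box d R))) :
    anchoredProfile d n ω = anchoredProfile d n ω' := by
  rw [anchoredProfile, anchoredProfile,
    Set.Subset.antisymm (anchoredProfile_ratioSet_subset_of_inter_eq hR hω hω' h)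
      (anchoredProfile_ratioSet_subset_of_inter_eq hR hω' hω h.symm)]

end Locality

/-! ## §8 Measurability -/

section Measurability

/-- The lattice part `ω ∩ E(ℤ^d)` of a configuration, fed into `φ̂_n`, gives a function
determined by the finitely many lattice edges inside `B(n^d)`; hence every one of its level sets
is measurable (Grimmett 1999, §2.2: events "defined in terms of the states of finitely many
edges"). [cite: CerfDembin2020, §1 (definition of φ̂_n)] -/
theorem measurable_anchoredProfile_inter (n : ℕ) :
    Measurable fun ω : BondConfig (Site d) => anchoredProfile d n (ω ∩ (zdGraph d).edgeSet) := by
  intro B _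
  refine DeterminedBy.measurableSet_of_finset (F := edgesIn (zdGraph d) (box d (n ^ d))) ?_
  rw [determinedBy_iff]
  intro ω ω' h
  have hagree : ω ∩ (zdGraph d).edgeSet ∩ ↑(edgesIn (zdGraph d) (box d (n ^ d))) =
      ω' ∩ (zdGraph d).edgeSet ∩ ↑(edgesIn (zdGraph d) (box d (n ^ d))) := by
    rw [Set.inter_right_comm, h, Set.inter_right_comm]
  simp only [Set.mem_preimage]
  rw [anchoredProfile_congr le_rfl Set.inter_subset_right Set.inter_subset_right hagree]

/-- **`φ̂_n` is `P_p`-a.e. measurable**: it coincides a.s. with the measurable local function of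
the previous lemma, since `ω ⊆ E(ℤ^d)` almost surely. [cite: CerfDembin2020, §1 (definition of φ̂_n)] -/
theorem aemeasurable_anchoredProfile (n : ℕ) (p : unitInterval) :
    AEMeasurable (anchoredProfile d n) (bondPercolation (zdGraph d) p) := by
  refine ⟨fun ω => anchoredProfile d n (ω ∩ (zdGraph d).edgeSet),
    measurable_anchoredProfile_inter n, ?_⟩
  have hsub : ∀ᵐ ω ∂(bondPercolation (zdGraph d) p), ω ⊆ (zdGraph d).edgeSet :=
    ProbabilityTheory.setBernoulli_ae_subset
  filter_upwards [hsub] with ω hω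
  rw [Set.inter_eq_left.2 hω]

/-- The scaled profile `n φ̂_n` is `P_p`-a.e. measurable as well.
[cite: CerfDembin2020, §1 (definition of φ̂_n)] -/
theorem aemeasurable_mul_anchoredProfile (n : ℕ) (p : unitInterval) :
    AEMeasurable (fun ω => (n : ℝ) * anchoredProfile d n ω) (bondPercolation (zdGraph d) p) :=
  (aemeasurable_anchoredProfile n p).const_mul _

end Measurability

end Literature.Probability.Percolation
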